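import Summits.Ventures.CertifiedArithmetic.Expansions.CompressTopFaithful
import Summits.Ventures.CertifiedArithmetic.Expansions.CompressFixedPointChain
import Summits.Ventures.CertifiedArithmetic.Expansions.CompressLocality
import Summits.Ventures.CertifiedArithmetic.Expansions.CompressCarryBound
import Mathlib.Tactic.Linarith
import Mathlib.Tactic.Positivity
import Mathlib.Tactic.Ring
import Mathlib.Tactic.NormNum

/-!
# COMPRESS twice: tools for the stability of the top component (new work, part 1 of 3)

New work of the certified-arithmetic venture (ENGINES group: shared numerical engines serving
client cells; rigour lives in the verifiers; every published number belongs to a client cell's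
ledger, not to the engines group), on the tree's formalisation of Shewchuk's COMPRESS
[Shewchuk1997, §2.7, Theorem 23] (`Literature…Shewchuk1997.Compress`).

THE QUESTION (this series of three files).  COMPRESS is not idempotent (`CompressNotIdempotent…`,
`CompressPassesUnbounded…`: a second pass may change the list, and the number of list-changing
passes is unbounded in the length).  What survives?  THE TOP COMPONENT: for every precision
`p ≥ 2`, every round-to-nearest `fl` (any tie rule, even an input-dependent one) and every
nonoverlapping expansion `e` of floats, the largest component of `COMPRESS(COMPRESS(e))` equals
the largest component of `COMPRESS(e)` (`compress_compress_getLast`, part 3).  All the later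
movement happens strictly below the top.

THIS FILE collects the tools.  Rounding (any round-to-nearest): absorption `fl(b + y) = b` when
`|y|` is below half the ulp of the binade of `b + y` (`fl_add_eq_self_of_le_abs`), by monotonicity
between two arguments already rounded to `b` (`fl_add_eq_self_of_between`), and by ADJACENCY —
no float strictly between `b` and a float `g`, `y` pointing towards `g` and shorter than half the
gap (`fl_add_eq_self_of_gap`); the quarter-ulp bound for a roundoff absorbed INTO a power of two
from inside (`abs_le_of_fl_add_eq_pow`); the spacing of floats above a float
(`abs_add_ulp_le_abs`).  COMPRESS plumbing: the top component of `compress fl (l ++ [r, x])` when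
`x` absorbs `r` is `fl(x + T)`, `T` the top of `compress fl (l ++ [r])`
(`getLast?_compress_append_absorbed`), hence the READ-OUT of the top of the second pass from a
state of the first pass's upward traversal (`getLast?_compress_state`); and what Theorem 23 and
`compress_top_isFaithful` say about the top `T` of COMPRESS of the components emitted so far
(`compress_rev_top`: a nonzero float, a faithful rounding of their sum `σ`, `|σ − T| < ulp T`,
same sign as `σ`).

References: J. R. Shewchuk, Adaptive precision floating-point arithmetic and fast robust geometric
predicates, Discrete Comput. Geom. 18 (1997) 305–363, §2.7 [Shewchuk1997]; S. Boldo,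
C.-P. Jeannerod, G. Melquiond, J.-M. Muller, Floating-point arithmetic, Acta Numerica 32 (2023),
§2 (ulp, Properties 2.7–2.9, FAST-TWO-SUM) [BoldoEtAl2023].
-/

namespace Summit.Ventures.CertifiedArithmetic.Expansions

open Literature.ComputerArithmetic.JeannerodRump2018
open Literature.ComputerArithmetic.BoldoJeannerodMelquiondMuller2023 hiding twoSum twoSum_fst
open Literature.ComputerArithmetic.GraillatMuller2025 (ulp_two_zpow)
open Literature.ComputerArithmetic.Shewchuk1997

variable {p : ℕ} {emin : ℤ} {fl : ℚ → ℚ}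

/-! ### Rounding to nearest: absorption and spacing -/

/-- An absorbed addend is at most half an ulp: `fl(b + y) = b ⟹ |y| ≤ ulp(b)/2`.
[cite: BoldoEtAl2023, §2.6 Property 2.7] -/
theorem abs_le_half_ulp_of_fl_add_eq (hp : 1 ≤ p) (hfl : IsRoundNearest p emin fl) {b y : ℚ}
    (h : fl (b + y) = b) : |y| ≤ ulp p emin b / 2 := by
  have := abs_sub_fl_le_half_ulp_fl hp hfl (b + y)
  rwa [h, show b + y - b = y by ring] at this

/-- ABSORPTION BELOW HALF THE ULP OF THE BINADE: if `b` is a float, `|b + y| ≥ 2^e` and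
`|y| < 2^(e−p+1)/2` (half the ulp of the binade `[2^e, 2^(e+1))`, `e − p + 1 ≥ emin`), then
`fl(b + y) = b` under any round-to-nearest. [cite: BoldoEtAl2023, §2.6 Property 2.7] -/
theorem fl_add_eq_self_of_le_abs (hp : 1 ≤ p) (hfl : IsRoundNearest p emin fl) {b y : ℚ}
    (hb : IsFloat p emin b) {e : ℤ} (he : emin ≤ e - p + 1) (hby : (2 : ℚ) ^ e ≤ |b + y|)
    (hy : |y| < (2 : ℚ) ^ (e - p + 1) / 2) : fl (b + y) = b := by
  apply fl_eq_of_abs_sub_lt_half_ulp hp hfl hb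
  have hu : (2 : ℚ) ^ (e - p + 1) ≤ ulp p emin (b + y) := by
    rw [← ulp_two_zpow (p := p) (emin := emin) he]
    exact ulp_mono (by rw [abs_of_pos (zpow_pos (by norm_num : (0 : ℚ) < 2) e)]; exact hby)
  rw [show b + y - b = y by ring]
  linarith

/-- THE QUARTER-ULP BOUND AT A POWER OF TWO: if `|b| = 2^h` (`h − p ≥ emin`, so that the
predecessor of `|b|` is `2^h − 2^(h−p)`), `y` points from `b` towards zero and `fl(b + y) = b`,
then `|y| ≤ 2^(h−p)/2 = ulp(b)/4`. [cite: BoldoEtAl2023, §2.1 (spacing below a power of 2)] -/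
theorem abs_le_of_fl_add_eq_pow (hp : 1 ≤ p) (hfl : IsRoundNearest p emin fl) {b y : ℚ}
    {h : ℤ} (hb : |b| = (2 : ℚ) ^ h) (hh : emin ≤ h - p) (hby : b * y < 0)
    (habs : fl (b + y) = b) : |y| ≤ (2 : ℚ) ^ (h - p) / 2 := by
  have h2hp : (0 : ℚ) < (2 : ℚ) ^ (h - p) := zpow_pos (by norm_num) _
  have h2h : (0 : ℚ) < (2 : ℚ) ^ h := zpow_pos (by norm_num) _
  have hulp : ulp p emin b = (2 : ℚ) ^ (h - p + 1) := by
    rw [← ulp_abs, hb]; exact ulp_two_zpow (by omega)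
  have hhalf : |y| ≤ (2 : ℚ) ^ (h - p) := by
    have := abs_sub_fl_le_half_ulp_fl hp hfl (b + y)
    rw [habs, show b + y - b = y by ring, hulp, zpow_add_one₀ (by norm_num : (2 : ℚ) ≠ 0)]
      at this
    linarith
  have hcF : IsFloat p emin (((2 : ℚ) ^ p - 1) * (2 : ℚ) ^ (h - p)) := by
    refine ⟨2 ^ p - 1, h - p, ?_, hh, by push_cast; ring⟩
    have h1 : (1 : ℤ) ≤ 2 ^ p := one_le_pow₀ (by norm_num)
    rw [abs_of_nonneg (by omega)]; omega
  have hc_val :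
      ((2 : ℚ) ^ p - 1) * (2 : ℚ) ^ (h - p) = (2 : ℚ) ^ h - (2 : ℚ) ^ (h - p) := by
    have : (2 : ℚ) ^ (p : ℕ) * (2 : ℚ) ^ (h - p) = (2 : ℚ) ^ h := by
      rw [← zpow_natCast, ← zpow_add₀ (by norm_num : (2 : ℚ) ≠ 0)]; congr 1; ring
    rw [sub_mul, one_mul, this]
  rcases (abs_eq h2h.le).mp hb with hbp | hbn
  · -- `b = 2^h`, `y < 0`
    have hy : y < 0 := by
      by_contra hc; rw [not_lt] at hc; rw [hbp] at hby; linarith [mul_nonneg h2h.le hc]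
    have hopt := (hfl (b + y)).2 _ hcF
    rw [habs, show b + y - b = y by ring, hc_val, hbp,
      show (2 : ℚ) ^ h + y - ((2 : ℚ) ^ h - (2 : ℚ) ^ (h - p)) = y + (2 : ℚ) ^ (h - p) by
        ring,
      abs_of_neg hy] at hopt
    rw [abs_of_neg hy]
    rcases le_or_gt 0 (y + (2 : ℚ) ^ (h - p)) with hs | hs
    · rw [abs_of_nonneg hs] at hopt; linarith
    · rw [abs_of_neg hs] at hopt; linarith
  · -- `b = −2^h`, `y > 0`
    have hy : 0 < y := by
      by_contra hc; rw [not_lt] at hc; rw [hbn] at hby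
      nlinarith [mul_nonneg h2h.le (neg_nonneg.mpr hc)]
    have hopt := (hfl (b + y)).2 _ hcF.neg
    rw [habs, show b + y - b = y by ring, hc_val, hbn,
      show -(2 : ℚ) ^ h + y - -((2 : ℚ) ^ h - (2 : ℚ) ^ (h - p)) = y - (2 : ℚ) ^ (h - p) by
        ring,
      abs_of_pos hy] at hopt
    rw [abs_of_pos hy]
    rcases le_or_gt 0 (y - (2 : ℚ) ^ (h - p)) with hs | hs
    · rw [abs_of_nonneg hs] at hopt; linarith
    · rw [abs_of_neg hs] at hopt; linarith

/-- SPACING ABOVE A FLOAT: a float `f` beyond a float `g` in magnitude is at least `ulp g` beyond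
(both lie on the grid of `ulp g`). [cite: BoldoEtAl2023, §2.1 Def. 2.4] -/
theorem abs_add_ulp_le_abs {f g : ℚ} (hf : IsFloat p emin f) (hg : IsFloat p emin g)
    (h : |g| < |f|) : |g| + ulp p emin g ≤ |f| := by
  obtain ⟨u, -, hu⟩ := exists_ulp_eq_two_zpow (p := p) (emin := emin) g
  have hgG : OnGrid u g := onGrid_of_two_zpow_le_ulp hg (by rw [hu])
  have hfG : OnGrid u f :=
    onGrid_of_two_zpow_le_ulp hf (by rw [← hu]; exact ulp_mono h.le)
  have hd : OnGrid u (|f| - |g|) := hfG.abs.sub hgG.abs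
  have h2 := hd.two_zpow_le_abs (sub_pos.mpr h).ne'
  rw [abs_of_pos (sub_pos.mpr h), ← hu] at h2
  linarith

/-- A faithful rounding stays within any float bound on the magnitude of its argument
(Property 2.9 on both sides). [cite: BoldoEtAl2023, §2.6 Property 2.9] -/
theorem abs_le_abs_of_isFaithful {t r F : ℚ} (h : IsFaithful p emin t r)
    (hF : IsFloat p emin F) (htF : |t| ≤ |F|) : |r| ≤ |F| :=
  abs_le.mpr ⟨h.ge_of_ge (isFloat_abs hF).neg (abs_le.mp htF).1,
    h.le_of_le (isFloat_abs hF) (abs_le.mp htF).2⟩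

/-- ABSORPTION BY MONOTONICITY: if `fl(a + q) = a` for a float `a`, then `fl(a + x) = a` for every
`x` between `0` and `q`. [cite: BoldoEtAl2023, §2.2 Def. 2.3 (monotonicity)] -/
theorem fl_add_eq_self_of_between (hfl : IsRoundNearest p emin fl) {a x q : ℚ}
    (ha : IsFloat p emin a) (hq : fl (a + q) = a) (h0 : 0 ≤ x * q) (hxq : |x| ≤ |q|) :
    fl (a + x) = a := by
  have hfa : fl a = a := fl_eq_self hfl ha
  rcases lt_trichotomy q 0 with hq0 | hq0 | hq0
  · have hx0 : x ≤ 0 := by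
      by_contra hc; rw [not_le] at hc; nlinarith [mul_pos hc (neg_pos.mpr hq0)]
    have hxq' : q ≤ x := by rw [abs_of_nonpos hx0, abs_of_neg hq0] at hxq; linarith
    have h1 := fl_mono hfl (show a + q ≤ a + x by linarith)
    have h2 := fl_mono hfl (show a + x ≤ a by linarith)
    rw [hq] at h1; rw [hfa] at h2; exact le_antisymm h2 h1
  · subst hq0
    have hx : x = 0 := by simpa using abs_nonpos_iff.mp (by simpa using hxq)
    subst hx; exact hq
  · have hx0 : 0 ≤ x := by
      by_contra hc; rw [not_le] at hc; nlinarith [mul_pos (neg_pos.mpr hc) hq0]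
    have hxq' : x ≤ q := by rw [abs_of_nonneg hx0, abs_of_pos hq0] at hxq; exact hxq
    have h1 := fl_mono hfl (show a ≤ a + x by linarith)
    have h2 := fl_mono hfl (show a + x ≤ a + q by linarith)
    rw [hfa] at h1; rw [hq] at h2; exact le_antisymm h2 h1

/-- ABSORPTION BY ADJACENCY: let `a` be a float and `g` a number with NO FLOAT STRICTLY BETWEEN
`a` and `g`; if `x` points from `a` towards `g` and `|x|` is less than half the gap `|g − a|`,
then `fl(a + x) = a` — `a` is then the unique float nearest to `a + x`.
[cite: BoldoEtAl2023, §2.2 (round-to-nearest)] -/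
theorem fl_add_eq_self_of_gap (hfl : IsRoundNearest p emin fl) {a g x : ℚ}
    (ha : IsFloat p emin a) (hadj : ∀ f : ℚ, IsFloat p emin f → 0 ≤ (f - a) * (f - g))
    (hx : 0 < x * (g - a)) (h2x : 2 * |x| < |g - a|) : fl (a + x) = a := by
  obtain ⟨hfF, hopt⟩ := hfl (a + x)
  have h1 : |a + x - fl (a + x)| ≤ |x| := by simpa using hopt a ha
  have hprod := hadj _ hfF
  have hD0 : g - a ≠ 0 := abs_pos.mp (by linarith [abs_nonneg x])
  by_contra hne
  rcases lt_or_gt_of_ne hD0 with hD | hD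
  · -- `g < a`: `x < 0`
    have hx0 : x < 0 := by
      by_contra hc; rw [not_lt] at hc; linarith [mul_nonneg hc (neg_pos.mpr hD).le]
    rw [abs_of_neg hx0, abs_of_neg hD] at h2x
    rw [abs_of_neg hx0] at h1
    rcases lt_or_gt_of_ne hne with hfa | hfa
    · -- near side: the float is at or beyond `g`
      have hfg : fl (a + x) - g ≤ 0 := by
        by_contra hc; rw [not_le] at hc
        linarith [mul_neg_of_neg_of_pos (sub_neg.mpr hfa) hc]
      rw [abs_of_pos (by linarith)] at h1; linarith
    · -- far side
      rw [abs_of_neg (by linarith)] at h1; linarith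
  · -- `a < g`: `x > 0`
    have hx0 : 0 < x := by
      by_contra hc; rw [not_lt] at hc
      linarith [mul_nonneg (neg_nonneg.mpr hc) hD.le]
    rw [abs_of_pos hx0, abs_of_pos hD] at h2x
    rw [abs_of_pos hx0] at h1
    rcases lt_or_gt_of_ne hne with hfa | hfa
    · -- far side
      rw [abs_of_pos (by linarith)] at h1; linarith
    · -- near side: the float is at or beyond `g`
      have hfg : 0 ≤ fl (a + x) - g := by
        by_contra hc; rw [not_le] at hc
        linarith [mul_neg_of_pos_of_neg (sub_pos.mpr hfa) hc]
      rw [abs_of_neg (by linarith)] at h1; linarith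

/-! ### COMPRESS plumbing: reading the top of the second pass -/

/-- THE TOP OVER AN ABSORBED TOP PAIR: if `x` absorbs the nonzero float `r` (`fl(x + r) = x`,
`fl 0 = 0`), the top component of `COMPRESS(l ++ [r, x])` is `fl(x + T)`, `T` the top
component of `COMPRESS(l ++ [r])`. [cite: Shewchuk1997, §2.7 p. 332 (COMPRESS)] -/
theorem getLast?_compress_append_absorbed (h0 : fl 0 = 0) (l : List ℚ) {r x : ℚ}
    (hr : fl r = r) (hx : fl (x + r) = x) (hr0 : r ≠ 0) :
    ∃ T, (compress fl (l ++ [r])).getLast? = some T ∧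
      (compress fl (l ++ [r, x])).getLast? = some (fl (x + T)) := by
  have hft : fastTwoSum fl x r = (x, r) := fastTwoSum_eq_of_absorb h0 hr hx
  have hne : (fastTwoSum fl x r).2 ≠ 0 := by rw [hft]; exact hr0
  obtain ⟨ys, T, h1, h2⟩ := compress_append_pair_of_ne_zero fl l hne
  rw [hft] at h1 h2
  refine ⟨T, by rw [h1]; simp, ?_⟩
  rw [h2]
  split_ifs <;> simp [fastTwoSum]

/-- READ-OUT.  Let `(rs, Q)` be a state of the upward traversal (`rs` the components emitted so
far, newest first, so that the final output is `rs.reverse ++ [Q]`).  If `Q` absorbs the newest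
component `r` (`fl(Q + r) = Q`, `r` a nonzero float) and `fl(Q + T) = Q` for the top `T` of
`COMPRESS(rs.reverse)`, then the top of `COMPRESS(rs.reverse ++ [Q])` is `Q`.
[cite: Shewchuk1997, §2.7 p. 332 (COMPRESS)] -/
theorem getLast?_compress_state (h0 : fl 0 = 0) {rs : List ℚ} {Q : ℚ}
    (hb : ∀ r ∈ rs.head?, fl r = r ∧ r ≠ 0 ∧ fl (Q + r) = Q)
    (hJ : ∀ T, (compress fl rs.reverse).getLast? = some T → fl (Q + T) = Q) :
    (compress fl (rs.reverse ++ [Q])).getLast? = some Q := by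
  cases rs with
  | nil => simp [compress]
  | cons r rest =>
    obtain ⟨hr, hr0, hQr⟩ := hb r (by simp)
    obtain ⟨T, h1, h2⟩ := getLast?_compress_append_absorbed h0 rest.reverse hr hQr hr0
    rw [show (r :: rest).reverse ++ [Q] = rest.reverse ++ [r, Q] by simp, h2,
      hJ T (by rw [List.reverse_cons]; exact h1)]

/-- THE TOP OF COMPRESS OF THE EMITTED COMPONENTS.  If `rs` (newest first) are nonzero floats,
each lying 1-below the newer ones (as the invariant `UpInv` of Theorem 23 guarantees), and `T`
is the top component of `COMPRESS(rs.reverse)`, then `T` is a float, a faithful rounding of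
`σ = Σ rs` with `|σ − T| < ulp T`, nonzero and of the sign of `σ`.
[cite: Shewchuk1997, Thm 23 p. 331] [cite: BoldoEtAl2023, §2.6 Property 2.8] -/
theorem compress_rev_top (hp : 2 ≤ p) (hfl : IsRoundNearest p emin fl) {rs : List ℚ}
    (hF : ∀ r ∈ rs, IsFloat p emin r) (hpw : rs.Pairwise (fun a b => Below 1 b a))
    (hne : ∀ r ∈ rs, r ≠ 0) {T : ℚ} (hT : (compress fl rs.reverse).getLast? = some T) :
    IsFloat p emin T ∧ IsFaithful p emin rs.sum T ∧ |rs.sum - T| < ulp p emin T ∧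
      T ≠ 0 ∧ 0 < T * rs.sum := by
  have hp1 : 1 ≤ p := le_trans (by norm_num) hp
  have he : ∀ x ∈ rs.reverse, IsFloat p emin x := fun x hx => hF x (List.mem_reverse.mp hx)
  have hexp : IsExpansion 1 rs.reverse := List.pairwise_reverse.mpr hpw
  have out := compress_spec hp hfl le_rfl (roundoffBelow_one hp1 hfl) he hexp
  have hmem : T ∈ (compress fl rs.reverse).getLast? := Option.mem_def.mpr hT
  have hTF : IsFloat p emin T := out.floats T (List.mem_of_getLast? hT)
  have hfaith : IsFaithful p emin rs.sum T := by
    have := compress_top_isFaithful hp hfl he hexp T hmem; rwa [List.sum_reverse] at this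
  have happrox : |rs.sum - T| < ulp p emin T := by
    have := out.approx T hmem; rwa [out.sum_eq, List.sum_reverse] at this
  have hT0 : T ≠ 0 := by
    rcases out.nz with h | h
    · exact h T (List.mem_of_getLast? hT)
    · rw [h, List.sum_reverse] at hT
      have hTs : T = rs.sum := by simpa using hT.symm
      cases rs with
      | nil => simp [compress] at h
      | cons r tail =>
        have hlt := abs_sum_tail_lt_head hF hpw hne
        rw [hTs, List.sum_cons]
        intro h0
        have : |r| = |tail.sum| := by rw [show r = -tail.sum by linarith, abs_neg]
        linarith
  have hsign : 0 < T * rs.sum := by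
    have hlt : |rs.sum - T| < |T| := happrox.trans_le (ulp_le_abs_of_isFloat hTF hT0)
    rcases lt_or_gt_of_ne hT0 with hTn | hTp
    · rw [abs_of_neg hTn] at hlt
      have hs : rs.sum < 0 := by linarith [le_abs_self (rs.sum - T)]
      exact mul_pos_of_neg_of_neg hTn hs
    · rw [abs_of_pos hTp] at hlt
      have hs : 0 < rs.sum := by linarith [neg_abs_le (rs.sum - T)]
      exact mul_pos hTp hs
  exact ⟨hTF, hfaith, happrox, hT0, hsign⟩

end Summit.Ventures.CertifiedArithmetic.Expansions
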